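import Summits.HodgeConjecture.CorCM.Model.PolarContraction
import HarnessLib

/-!
# COR-CM model layer, row M22 `Fact_algDuality`, kernel K-b (part 4): the polar matrix is alternating, the Euler
# identity `Σ_a b_a ∪ y_a = 2 θ`, and the polar family packaged as a basis

Cell `pub-hodgecm2` (COR-CM), seat `b16`, row M22 K-b; small complements to `CorCM/Model/PolarContraction.lean` for the
consumers of the polar family `y` of a class `θ ∈ H²(A(ℂ); ℚ)` along a basis `b` of `H¹(A(ℂ); ℚ)`
(`m^*θ - pr₁^*θ - pr₂^*θ = Σ_a pr₁^* b_a ∪ pr₂^* y_a`, `CorCM/Model/PoincareClass.lean`):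

* `polarFamily_repr_antisymm` — the polar matrix `E_{a a'} = b^*_{a'}(y_a)` (so `y_a = Σ_{a'} E_{a a'} b_{a'}`) is alternating,
  `E_{a a'} = -E_{a' a}` — the hypothesis `hE` of the cell's Rosati-tensor engine `RosatiTensor.sum_tmul_rosati_of_balanced`;
* `sum_cup_polarFamily_eq_two_smul` — the Euler identity `Σ_a b_a ∪ y_a = 2 • θ` (i.e. `θ = ½ Σ_{a,a'} E_{a a'} b_a ∪ b_{a'}`);
* `sum_cup_pull_polarFamily_eq_zero_of_balanced` — balance transfer: `G^* = 1 + F^*` on `H¹` and `G^*θ = θ + F^*θ`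
  (i.e. `(𝟙 + u)^*θ = θ + u^*θ`) give `Σ_a (F^* b_a ∪ y_a + b_a ∪ F^* y_a) = 0` — the cup-form hypothesis `hbal` of
  `RosatiTensor.sum_tmul_rosati_of_balanced`;
* `exists_basis_coe_eq_polarFamily` — for `θ^{dim A} ≠ 0` the polar family IS a basis of `H¹(A(ℂ); ℚ)` (packaging of
  `polarFamily_linearIndependent` + `polarFamily_span_eq_top` as `∃ B : Basis, ⇑B = y`, the input shape of the K-a socket
  `Model.fourierSum … (b y : Basis …)`).

Definition-free; proofs = the contraction calculus of part 3 (`contraction_cup_one_one`) and span induction over cups of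
degree-one classes.  Template: `Motives/AbelianVarietyExterior.lean` (`coprod_one_one_eq_sum`, `polBasis`).

## References
* [MumfordAV1970] D. Mumford, *Abelian Varieties* (1970), §1 (4), §6, §16.
* [LangeBirkenhake1992] H. Lange, Ch. Birkenhake, *Complex Abelian Varieties* (1992), Lemma 1.1.17; (2023 ed.) §6.2.4.
-/

noncomputable section

open CategoryTheory MonoidalCategory CartesianMonoidalCategory
open Literature.AlgebraicTopology.SingularHomology
open Literature.AlgebraicTopology.CharacteristicClasses (cupPow)
open Literature.AlgebraicGeometry.Motives (SchemeOver ComplexPoints IsSmoothProjective bettiCohomology AbelianVariety)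
open Literature.AlgebraicGeometry.HodgeTheory
open Literature.NumberTheory.Automorphic.PicardCM

namespace Summit.HodgeConjecture.CorCM.Model

/-! ### Antisymmetry of the polar matrix and the Euler identity `Σ_a b_a ∪ y_a = 2 θ` -/

section PolarMatrix

open scoped MonObj

variable (A : AbelianVariety ℂ)

/-- **The polar matrix is alternating**: for a basis `b` of `H¹(A(ℂ); ℚ)` and the polar family `y` of `θ` along `b`,
the matrix `E_{a a'} = b^*_{a'}(y_a)` (so `y_a = Σ_{a'} E_{a a'} b_{a'}`, `θ = ½ Σ E_{a a'} b_a ∪ b_{a'}`) satisfies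
`E_{a a'} = -E_{a' a}` (on `θ = u ∪ v`: `b^*_{a'}(D_a(u ∪ v)) = b^*_a(u) b^*_{a'}(v) - b^*_a(v) b^*_{a'}(u)`).  This is the
antisymmetry hypothesis `hE` of the cell's Rosati-tensor engine `RosatiTensor.sum_tmul_rosati_of_balanced`. [cite: MumfordAV1970, §16] -/
theorem polarFamily_repr_antisymm {n : ℕ} (b : Module.Basis (Fin n) ℚ (bettiCohomology A.X 1))
    {θ : bettiCohomology A.X 2} {y : Fin n → bettiCohomology A.X 1}
    (hℓ : BettiUniverse.pull μ[A.X] 2 θ - BettiUniverse.pull (fst A.X A.X) 2 θ - BettiUniverse.pull (snd A.X A.X) 2 θ =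
      ∑ a, BettiUniverse.cup (A.X ⊗ A.X) 1 1 (BettiUniverse.pull (fst A.X A.X) 1 (b a))
        (BettiUniverse.pull (snd A.X A.X) 1 (y a)))
    (a a' : Fin n) : b.repr (y a) a' = -b.repr (y a') a := by
  have h := hasExteriorCohomologyH1_rat A
  have hex := fun c : Fin n ↦ exists_contraction h (b.coord c)
  choose D hD using hex
  rw [polarFamily_eq_contraction A b hℓ D hD a, polarFamily_eq_contraction A b hℓ D hD a']
  -- now a statement about `θ` alone: span induction over cups of degree-one classes
  clear hℓ
  have hθ : θ ∈ Submodule.span ℚ (Set.range (cupPowOne ℚ (ComplexPoints A.X) 2)) := by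
    rw [span_range_cupPowOne_rat_eq_top A 2]; exact Submodule.mem_top
  induction hθ using Submodule.span_induction with
  | mem θ hθ =>
    obtain ⟨u, rfl⟩ := hθ
    rw [cupPowOne_succ, cupPowOne_one, contraction_cup_one_one (b.coord a) (D a) h (hD a),
      contraction_cup_one_one (b.coord a') (D a') h (hD a')]
    simp only [map_sub, map_smul, Finsupp.coe_sub, Finsupp.coe_smul, Pi.sub_apply, Pi.smul_apply, smul_eq_mul,
      Module.Basis.coord_apply]
    ring
  | zero => simp
  | add θ θ' _ _ hθ hθ' =>
    simp only [map_add, Finsupp.coe_add, Pi.add_apply, hθ, hθ', neg_add]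
  | smul r θ _ hθ =>
    simp only [map_smul, Finsupp.coe_smul, Pi.smul_apply, hθ, smul_eq_mul, mul_neg]

/-- **Euler identity `Σ_a b_a ∪ y_a = 2 • θ`** for a basis `b` of `H¹(A(ℂ); ℚ)` and the polar family `y` of `θ` along `b`
(on `θ = u ∪ v`: `Σ_a b_a ∪ (b^*_a(u) v - b^*_a(v) u) = u ∪ v - v ∪ u = 2 u ∪ v`); i.e. `θ = ½ Σ_{a,a'} E_{a a'} b_a ∪ b_{a'}`
with the polar matrix `E`.  (Equivalently: pull `ℓ(θ)` back along the diagonal, `[2]^* = 4` on `H²`.) [cite: MumfordAV1970, §6 and §16] -/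
theorem sum_cup_polarFamily_eq_two_smul {n : ℕ} (b : Module.Basis (Fin n) ℚ (bettiCohomology A.X 1))
    {θ : bettiCohomology A.X 2} {y : Fin n → bettiCohomology A.X 1}
    (hℓ : BettiUniverse.pull μ[A.X] 2 θ - BettiUniverse.pull (fst A.X A.X) 2 θ - BettiUniverse.pull (snd A.X A.X) 2 θ =
      ∑ a, BettiUniverse.cup (A.X ⊗ A.X) 1 1 (BettiUniverse.pull (fst A.X A.X) 1 (b a))
        (BettiUniverse.pull (snd A.X A.X) 1 (y a))) :
    ∑ a, BettiUniverse.cup A.X 1 1 (b a) (y a) = (2 : ℚ) • θ := by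
  have h := hasExteriorCohomologyH1_rat A
  have hex := fun c : Fin n ↦ exists_contraction h (b.coord c)
  choose D hD using hex
  rw [Finset.sum_congr rfl fun a _ ↦ by rw [polarFamily_eq_contraction A b hℓ D hD a]]
  clear hℓ
  have hθ : θ ∈ Submodule.span ℚ (Set.range (cupPowOne ℚ (ComplexPoints A.X) 2)) := by
    rw [span_range_cupPowOne_rat_eq_top A 2]; exact Submodule.mem_top
  induction hθ using Submodule.span_induction with
  | mem θ hθ =>
    obtain ⟨u, rfl⟩ := hθ
    rw [cupPowOne_succ, cupPowOne_one]
    simp only [contraction_cup_one_one _ _ h (hD _), map_sub, map_smul, Module.Basis.coord_apply]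
    rw [Finset.sum_sub_distrib]
    have h1 : ∀ w v : bettiCohomology A.X 1,
        ∑ a, b.repr w a • BettiUniverse.cup A.X 1 1 (b a) v = BettiUniverse.cup A.X 1 1 w v := fun w v ↦ by
      conv_rhs => rw [← b.sum_repr w]
      rw [LinearMap.map_sum₂]
      refine Finset.sum_congr rfl fun a _ ↦ ?_
      rw [LinearMap.map_smul₂]
    rw [h1, h1, BettiUniverse.cup_comm_one (Fin.tail u 0) (u 0), sub_neg_eq_add, two_smul]
  | zero => simp
  | add θ θ' _ _ hθ hθ' =>
    simp only [map_add, Finset.sum_add_distrib, hθ, hθ', smul_add]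
  | smul r θ _ hθ =>
    simp only [map_smul, ← Finset.smul_sum, hθ, smul_comm r (2 : ℚ)]

end PolarMatrix

/-! ### Balance transfer: `(𝟙 + u)^*θ = θ + u^*θ` ⇒ `Σ_a (u^* b_a ∪ y_a + b_a ∪ u^* y_a) = 0` -/

section Balance

open scoped MonObj

variable (A : AbelianVariety ℂ)

/-- **`K`-balance transfers from `θ` to its polar family.**  Let `F, G : A → A` be morphisms of `ℂ`-schemes with
`G^* = 1 + F^*` on `H¹(A(ℂ); ℚ)` (in practice `G = 𝟙 + u(c)`, `F = u(c)` for an endomorphism `u(c)` of the abelian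
variety, `pull_add_one`) and suppose the BALANCE identity `G^* θ = θ + F^* θ` on `H²`.  Then for a basis `b` of `H¹` and the
polar family `y` of `θ` along `b`: `Σ_a (F^* b_a ∪ y_a + b_a ∪ F^* y_a) = 0` in `H²(A(ℂ); ℚ)` — apply `G^*` to the Euler
identity `2 θ = Σ_a b_a ∪ y_a` and expand.  This is the cup-form balance hypothesis `hbal` of the cell's Rosati-tensor
engine `RosatiTensor.sum_tmul_rosati_of_balanced` (with `ι c := F^*|_{H¹}`). [cite: MumfordAV1970, §16 and §20] -/
theorem sum_cup_pull_polarFamily_eq_zero_of_balanced {n : ℕ} (b : Module.Basis (Fin n) ℚ (bettiCohomology A.X 1))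
    {θ : bettiCohomology A.X 2} {y : Fin n → bettiCohomology A.X 1}
    (hℓ : BettiUniverse.pull μ[A.X] 2 θ - BettiUniverse.pull (fst A.X A.X) 2 θ - BettiUniverse.pull (snd A.X A.X) 2 θ =
      ∑ a, BettiUniverse.cup (A.X ⊗ A.X) 1 1 (BettiUniverse.pull (fst A.X A.X) 1 (b a))
        (BettiUniverse.pull (snd A.X A.X) 1 (y a)))
    (F G : A.X ⟶ A.X) (hG : BettiUniverse.pull G 1 = LinearMap.id + BettiUniverse.pull F 1)
    (hbal : BettiUniverse.pull G 2 θ = θ + BettiUniverse.pull F 2 θ) :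
    ∑ a, (BettiUniverse.cup A.X 1 1 (BettiUniverse.pull F 1 (b a)) (y a) +
      BettiUniverse.cup A.X 1 1 (b a) (BettiUniverse.pull F 1 (y a))) = 0 := by
  have hE := sum_cup_polarFamily_eq_two_smul A b hℓ
  -- `G^*(2θ)` computed two ways
  have h1 : BettiUniverse.pull G 2 ((2 : ℚ) • θ) =
      (2 : ℚ) • θ + ∑ a, BettiUniverse.cup A.X 1 1 (BettiUniverse.pull F 1 (b a)) (BettiUniverse.pull F 1 (y a)) := by
    rw [map_smul, hbal, smul_add, ← map_smul (BettiUniverse.pull F 2), ← hE, map_sum]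
    refine congrArg _ (Finset.sum_congr rfl fun a _ ↦ ?_)
    rw [pull_cup_one_one]
  have h2 : BettiUniverse.pull G 2 ((2 : ℚ) • θ) =
      (2 : ℚ) • θ + ∑ a, BettiUniverse.cup A.X 1 1 (BettiUniverse.pull F 1 (b a)) (BettiUniverse.pull F 1 (y a)) +
        ∑ a, (BettiUniverse.cup A.X 1 1 (BettiUniverse.pull F 1 (b a)) (y a) +
          BettiUniverse.cup A.X 1 1 (b a) (BettiUniverse.pull F 1 (y a))) := by
    rw [← hE, map_sum, ← Finset.sum_add_distrib, ← Finset.sum_add_distrib]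
    refine Finset.sum_congr rfl fun a _ ↦ ?_
    rw [pull_cup_one_one, hG]
    simp only [LinearMap.add_apply, LinearMap.id_apply, map_add]
    abel
  have h := h1.symm.trans h2
  rwa [left_eq_add] at h

end Balance

/-! ### The polar family as a basis -/

section PolarBasis

open scoped MonObj

variable (A : AbelianVariety ℂ)

/-- **The polar family of a class with `θ^{dim A} ≠ 0` is a basis of `H¹(A(ℂ); ℚ)`**: there is a `Module.Basis (Fin n) ℚ`
whose vectors are the `y_a` (`Basis.mk` on `polarFamily_linearIndependent` / `polarFamily_span_eq_top`) — the shape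
`(b y : Basis (Fin N) ℚ (H¹ P))` in which the K-a socket `Model.fourierSum` and `FourierOpInjective`/`FourierSumBijective`
take the two bases. [cite: MumfordAV1970, §16] -/
theorem exists_basis_coe_eq_polarFamily {n k : ℕ} (hk : k + 1 = A.dim)
    (b : Module.Basis (Fin n) ℚ (bettiCohomology A.X 1))
    {θ : bettiCohomology A.X 2} (hθ : cupPow ℚ θ (k + 1) ≠ 0) {y : Fin n → bettiCohomology A.X 1}
    (hℓ : BettiUniverse.pull μ[A.X] 2 θ - BettiUniverse.pull (fst A.X A.X) 2 θ - BettiUniverse.pull (snd A.X A.X) 2 θ =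
      ∑ a, BettiUniverse.cup (A.X ⊗ A.X) 1 1 (BettiUniverse.pull (fst A.X A.X) 1 (b a))
        (BettiUniverse.pull (snd A.X A.X) 1 (y a))) :
    ∃ B : Module.Basis (Fin n) ℚ (bettiCohomology A.X 1), ⇑B = y :=
  ⟨Module.Basis.mk (polarFamily_linearIndependent A hk b hθ hℓ) (polarFamily_span_eq_top A hk b hθ hℓ).ge,
    Module.Basis.coe_mk _ _⟩

end PolarBasis

end Summit.HodgeConjecture.CorCM.Model

end
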